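import Summits.QuantumFields.BalabanUV.T4Continuum.Support.NE7SliceIterationStateFacts
import Summits.QuantumFields.BalabanUV.T4Continuum.Support.NE7EnergySliceClosed
import Summits.QuantumFields.BalabanUV.T4Continuum.Support.NE7RightInverseLinear
import Summits.QuantumFields.BalabanUV.T4Continuum.Support.NE7ExpLogSecondOrder
import Summits.QuantumFields.BalabanUV.T4Continuum.Support.NE3LinearisedAverageSup
import Summits.QuantumFields.BalabanUV.T4Continuum.Support.NE3RightInverseSupLetters
import HarnessLib

/-!
# NE7SliceTangentPartLimit — F4d-iii `tangentPart_limit_mem`: ALONG A SITEWISE-UNIFORMLY CONVERGENT ORBIT OF THE SLICE ITERATION WHOSE DEFECT TENDS TO ZERO, THE TANGENT PART OF THE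
# LIMIT GAUGE LIES IN THE ENERGY SLICE — `T(u⋆) ∈ 𝒯_E(W)` — because `T` is sup-Lipschitz in the gauge on the working region (`‖T(u) − T(v)‖_∞ ≤ C_T·sup‖u − v‖`), the slice parts
# `Ỹ(u_j) = T(u_j) − gaugeDir W ζ(u_j) ∈ 𝒯_E(W)` differ from `T(u_j)` by `≤ Df(u_j)`, and `𝒯_E(W)` is closed under sitewise limits (memo ROAD-G101 §10; OFFER (a) of t4-ne7-p1 g101, INBOX L.251x)

Cell `pub-balaban`, rung (B)+1 sub-cell t4, lineage `b2b-balaban-t4-ne7b-p1`, generation 150 (OWNER of BINDER row NE7b; junction service for the NE crew, ruling R-OWNER-149-1 (2)).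
A JUNCTION for row NE7 (node U5), asked by name by the road owner ([NE7P1-G101-INBOX-3] (a)): step F4d-iii of the supplier (S1).  The state maps are t4-ne7-p1 g101's
`NE7SliceIterationState` (`repLog` = `X(u)`, `cornerLog` = `h(u)`, `coarseDatum` = `φ(u)`, `normalPart` = `N(u)`, `tangentPart` = `T(u)`, `gaugeFun` = `ζ(u)`, `slicePart` = `Ỹ(u)`,
`sliceDefect` = `Df(u)`), their working-region facts `NE7SliceIterationStateFacts` (`split_holds`, `norm_gaugeDir_gaugeFun_le`, `delta_le_sliceDefect`, skewness ∕ periodicity), the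
closedness `NE7EnergySliceClosed.mem_energyBlockLandauW_of_tendsto`, the linearity `NE7RightInverseLinear.rightInvW_sub`, `NE3ResidualSliceRep.dirIter_sub`, and the sup letters
`NE3LinearisedAverageSup.norm_dirIter_le_sup` ((3+12d)·M), `NE3RightInverseSupLetters.norm_rightInvW_le` (R5), `norm_gaugeDir_le_two_mul`, the Lipschitz bound of the matrix logarithm
`NE7ExpLogSecondOrder.norm_mlog_sub_mlog_le_four_thirds`.
WHAT ([folklore]; 0 def, 0 sorry; multi-level small-field class at `W`, `L ≥ 2`, `M = L^{k+1}`).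
§1 pointwise Lipschitz letters between two gauges `u, v` of the working region: `norm_gaugeAct_sub_le` (`‖U′^u(b) − U′^v(b)‖ ≤ ‖u(b₋) − v(b₋)‖ + ‖u(b₊) − v(b₊)‖`),
   **`norm_repLog_sub_le`** (`‖X(u)(b) − X(v)(b)‖ ≤ (4∕3)(…)`), **`norm_cornerLog_sub_le`** (`‖h(u)(z) − h(v)(z)‖ ≤ (4∕3)‖u(M•z) − v(M•z)‖`).
§2 sup letters (`sup‖u − v‖ ≤ ρ`): `norm_repLog_sub_le_sup` (`≤ (8∕3)ρ`), **`norm_coarseDatum_sub_le`** (`≤ (8∕3)((3+12d)M + 1)·ρ`), **`norm_normalPart_sub_le`**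
   (`≤ supC∕(M(1 − cruxC·M²x))·(8∕3)((3+12d)M + 1)·ρ`), **`norm_tangentPart_sub_le`** (`≤ lipT·ρ`, `lipT := (8∕3)(1 + supC∕(M(1−cruxC·M²x))·((3+12d)M + 1))`).
§3 `norm_slicePart_sub_tangentPart_le` (`‖Ỹ(u) − T(u)‖ ≤ Df(u)` on the working region), **`tangentPart_limit_mem`** (F4d-iii: working region for every `u j` and for `u⋆`, a uniform rate
   `‖u j y − u⋆ y‖ ≤ r j → 0` — the Cauchy engine's `B·δ₀·θ^j∕(1−θ)` — and `Df(u j) → 0` ⟹ `tangentPart … u⋆ ∈ energyBlockLandauW L N (k+1) W`).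
HONEST FRAMING (page 1): continuity bookkeeping over the road's state maps and row NE3's sup letters BY NAME; nothing of Bałaban's asserted; NOT F4d-ii (the orbit limit `u⋆` and its
working-region facts are the successor's `slice_orbit_limit`), NOT F4e, NOT (S2), NOT NE7, nothing of row NE7b; spine 0∕9; finite T⁴ rung (B)+1 — NOT infinite volume, NOT mass gap, NOT
BetaPertH, NOT Clay.  Continuum YM on T⁴ ⇐ BetaPertH ∧ nine spine estimates (0/9 proved); BetaPertH ⇐ (D1) ∧ (D4) ∧ CAP+tail; G-an2-4 gates asym, D1 and NE2/3/4.
-/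

set_option autoImplicit false

open scoped BigOperators Matrix.Norms.L2Operator Topology
open NormedSpace Finset Filter

namespace Summit.QuantumFields.BalabanUV.T4Continuum.NE7SliceTangentPartLimit

open Literature.MathematicalPhysics.QuantumFieldTheory.Balaban1983to89
open B7Prop1Explicit B7Prop2Explicit MatrixLog
open T4AveragingDeficitWall (IsUnitaryCfg IsSkewDir SmallField vary)
open T4AveragingDeficitWallBoundary (IsPeriodicCfg)
open AveragingDeficitPeriodicCounting (IsPeriodicDir)
open AveragingDeficitMultiLevelPrep (cavgIter LevelSmall tower)
open AveragingDeficitKDatum (isUnitaryCfg_gaugeAct)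
open BlockAveragePushDirGauge (gaugeDir)
open BlockAverageLogInteraction (norm_exp_sub_one_le_two_mul)
open NE3EnergyShapes (IsUnitarySite IsPeriodicSite)
open NE3TangentCovariantTower (dirIter)
open NE3ResidualSliceRep (dirIter_sub)
open NE3QbarIterCovLiftPrep (cruxC)
open NE3SmoothRightInverseW (rightInvW)
open NE3LinearisedAverageSup (norm_dirIter_le_sup curvSum levelData)
open NE3RightInverseSupLetters (norm_rightInvW_le norm_gaugeDir_le_two_mul supC)
open NE7MeanZeroGaugeSliceW (energyBlockLandauW)
open NE7ExpLogSecondOrder (norm_mlog_sub_mlog_le_four_thirds)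
open NE7RightInverseLinear (rightInvW_sub)
open NE7EnergySliceClosed (mem_energyBlockLandauW_of_tendsto)
open NE7SliceIterationState
open NE7SliceIterationStateFacts (repLog_skew repLog_periodic cornerLog_skew coarseDatum_skew_periodic split_holds norm_gaugeDir_gaugeFun_le delta_le_sliceDefect)

noncomputable section

variable {d : ℕ} {n : Type*} [Fintype n] [DecidableEq n]

/-! ## §1 Pointwise Lipschitz letters between two gauges -/

/-- **THE GAUGED CONFIGURATION IS 1-LIPSCHITZ IN THE GAUGE, BOND BY BOND** (unitary `u`, `v`, `U′`): `‖U′^u(x,κ) − U′^v(x,κ)‖ ≤ ‖u x − v x‖ + ‖u(x+e_κ) − v(x+e_κ)‖`. [folklore] -/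
theorem norm_gaugeAct_sub_le [Nonempty n] {u v : Site d → (Matrix n n ℂ)ˣ} (hu : IsUnitarySite u) (hv : IsUnitarySite v) {U : Site d → Fin d → (Matrix n n ℂ)ˣ}
    (hU : IsUnitaryCfg U) (y : Site d) (κ : Fin d) :
    ‖((gaugeAct u U y κ : (Matrix n n ℂ)ˣ) : Matrix n n ℂ) - ((gaugeAct v U y κ : (Matrix n n ℂ)ˣ) : Matrix n n ℂ)‖
      ≤ ‖((u y : (Matrix n n ℂ)ˣ) : Matrix n n ℂ) - (v y : (Matrix n n ℂ)ˣ)‖ + ‖((u (y + e κ) : (Matrix n n ℂ)ˣ) : Matrix n n ℂ) - (v (y + e κ) : (Matrix n n ℂ)ˣ)‖ := by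
  have ha' : u (y + e κ) ∈ unitaryUnits (Matrix n n ℂ) := hu (y + e κ)
  have hb' : v (y + e κ) ∈ unitaryUnits (Matrix n n ℂ) := hv (y + e κ)
  have hGa' : (((U y κ * (u (y + e κ))⁻¹ : (Matrix n n ℂ)ˣ)) : Matrix n n ℂ) ∈ unitary (Matrix n n ℂ) :=
    mem_unitaryUnits.mp ((unitaryUnits _).mul_mem (hU y κ) ((unitaryUnits _).inv_mem ha'))
  have hbG : (((v y * U y κ : (Matrix n n ℂ)ˣ)) : Matrix n n ℂ) ∈ unitary (Matrix n n ℂ) :=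
    mem_unitaryUnits.mp ((unitaryUnits _).mul_mem (hv y) (hU y κ))
  -- the inverses differ by as much as the elements
  have hinv : ‖(((u (y + e κ))⁻¹ : (Matrix n n ℂ)ˣ) : Matrix n n ℂ) - (((v (y + e κ))⁻¹ : (Matrix n n ℂ)ˣ) : Matrix n n ℂ)‖
      = ‖((u (y + e κ) : (Matrix n n ℂ)ˣ) : Matrix n n ℂ) - (v (y + e κ) : (Matrix n n ℂ)ˣ)‖ := by
    have e1 : (((u (y + e κ))⁻¹ : (Matrix n n ℂ)ˣ) : Matrix n n ℂ) - (((v (y + e κ))⁻¹ : (Matrix n n ℂ)ˣ) : Matrix n n ℂ)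
        = (((u (y + e κ))⁻¹ : (Matrix n n ℂ)ˣ) : Matrix n n ℂ) * (((v (y + e κ) : (Matrix n n ℂ)ˣ) : Matrix n n ℂ) - (u (y + e κ) : (Matrix n n ℂ)ˣ))
          * (((v (y + e κ))⁻¹ : (Matrix n n ℂ)ˣ) : Matrix n n ℂ) := by
      rw [mul_sub, sub_mul, Units.inv_mul, one_mul, mul_assoc, Units.mul_inv, mul_one]
    rw [e1, CStarRing.norm_mul_mem_unitary _ (mem_unitaryUnits.mp ((unitaryUnits _).inv_mem hb')),
      CStarRing.norm_mem_unitary_mul _ (mem_unitaryUnits.mp ((unitaryUnits _).inv_mem ha')), norm_sub_rev]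
  have egauge : ∀ (w : Site d → (Matrix n n ℂ)ˣ), ((gaugeAct w U y κ : (Matrix n n ℂ)ˣ) : Matrix n n ℂ)
      = ((w y : (Matrix n n ℂ)ˣ) : Matrix n n ℂ) * (((U y κ * (w (y + e κ))⁻¹ : (Matrix n n ℂ)ˣ)) : Matrix n n ℂ) := fun w => by
    simp only [gaugeAct, Units.val_mul, mul_assoc]
  have esplit : ((gaugeAct u U y κ : (Matrix n n ℂ)ˣ) : Matrix n n ℂ) - ((gaugeAct v U y κ : (Matrix n n ℂ)ˣ) : Matrix n n ℂ)
      = (((u y : (Matrix n n ℂ)ˣ) : Matrix n n ℂ) - (v y : (Matrix n n ℂ)ˣ)) * (((U y κ * (u (y + e κ))⁻¹ : (Matrix n n ℂ)ˣ)) : Matrix n n ℂ)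
        + (((v y * U y κ : (Matrix n n ℂ)ˣ)) : Matrix n n ℂ)
          * ((((u (y + e κ))⁻¹ : (Matrix n n ℂ)ˣ) : Matrix n n ℂ) - (((v (y + e κ))⁻¹ : (Matrix n n ℂ)ˣ) : Matrix n n ℂ)) := by
    rw [egauge u, egauge v]
    simp only [Units.val_mul, sub_mul, mul_sub, ← mul_assoc]
    abel
  rw [esplit]
  refine (norm_add_le _ _).trans (le_of_eq ?_)
  rw [CStarRing.norm_mul_mem_unitary _ hGa', CStarRing.norm_mem_unitary_mul _ hbG, hinv]

section TwoStates

variable [Nonempty n] {L : ℕ} (k : ℕ) {W U' : Site d → Fin d → (Matrix n n ℂ)ˣ} (hWu : IsUnitaryCfg W) (hU'u : IsUnitaryCfg U')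
  {u v : Site d → (Matrix n n ℂ)ˣ} (hu : IsUnitarySite u) (hv : IsUnitarySite v)
  (hgu : gaugeAct u U' = vary W (repLog W U' u) 1) (hXu : ∀ y κ, ‖repLog W U' u y κ‖ ≤ 1 / 8)
  (hgv : gaugeAct v U' = vary W (repLog W U' v) 1) (hXv : ∀ y κ, ‖repLog W U' v y κ‖ ≤ 1 / 8)

include hgu hXu in
/-- on the working region `W(b)⁻¹U′^u(b) = e^{X(u)(b)}` is within `1∕4` of `1`. [folklore] -/
theorem norm_rel_sub_one_le (y : Site d) (κ : Fin d) :
    ‖((((W y κ)⁻¹ : (Matrix n n ℂ)ˣ) : Matrix n n ℂ) * ((gaugeAct u U' y κ : (Matrix n n ℂ)ˣ) : Matrix n n ℂ)) - 1‖ ≤ 1 / 4 := by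
  have hval : (((W y κ)⁻¹ : (Matrix n n ℂ)ˣ) : Matrix n n ℂ) * ((gaugeAct u U' y κ : (Matrix n n ℂ)ˣ) : Matrix n n ℂ) = exp (repLog W U' u y κ) := by
    have hg := congrFun (congrFun hgu y) κ
    rw [hg, vary, Units.val_mul, ← mul_assoc, Units.inv_mul, one_mul, val_expUnit, Complex.ofReal_one, one_smul]
  rw [hval]
  exact (norm_exp_sub_one_le_two_mul (hXu y κ) (by norm_num)).1.trans (by norm_num)

include hWu hU'u hu hv hgu hXu hgv hXv in
/-- **`X(·)(b)` IS `(4∕3)`-LIPSCHITZ IN THE GAUGE AT THE BOND's ENDPOINTS** on the working region. [folklore] -/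
theorem norm_repLog_sub_le (y : Site d) (κ : Fin d) :
    ‖repLog W U' u y κ - repLog W U' v y κ‖
      ≤ 4 / 3 * (‖((u y : (Matrix n n ℂ)ˣ) : Matrix n n ℂ) - (v y : (Matrix n n ℂ)ˣ)‖ + ‖((u (y + e κ) : (Matrix n n ℂ)ˣ) : Matrix n n ℂ) - (v (y + e κ) : (Matrix n n ℂ)ˣ)‖) := by
  have hA := norm_rel_sub_one_le hgu hXu y κ
  have hB := norm_rel_sub_one_le hgv hXv y κ
  have h := norm_mlog_sub_mlog_le_four_thirds (le_refl (1 / 4 : ℝ)) hA hB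
  have hWinv : ((((W y κ)⁻¹ : (Matrix n n ℂ)ˣ)) : Matrix n n ℂ) ∈ unitary (Matrix n n ℂ) := mem_unitaryUnits.mp ((unitaryUnits _).inv_mem (hWu y κ))
  have hdiff : ‖(((W y κ)⁻¹ : (Matrix n n ℂ)ˣ) : Matrix n n ℂ) * ((gaugeAct u U' y κ : (Matrix n n ℂ)ˣ) : Matrix n n ℂ)
        - (((W y κ)⁻¹ : (Matrix n n ℂ)ˣ) : Matrix n n ℂ) * ((gaugeAct v U' y κ : (Matrix n n ℂ)ˣ) : Matrix n n ℂ)‖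
      ≤ ‖((u y : (Matrix n n ℂ)ˣ) : Matrix n n ℂ) - (v y : (Matrix n n ℂ)ˣ)‖ + ‖((u (y + e κ) : (Matrix n n ℂ)ˣ) : Matrix n n ℂ) - (v (y + e κ) : (Matrix n n ℂ)ˣ)‖ := by
    rw [← mul_sub, CStarRing.norm_mem_unitary_mul _ hWinv]
    exact norm_gaugeAct_sub_le hu hv hU'u y κ
  unfold repLog
  exact h.trans (by linarith)

end TwoStates

/-- **`h(·)(z)` IS `(4∕3)`-LIPSCHITZ IN THE CORNER VALUE** on the working region (`u(M•z) = e^{h(u) z}`, `‖h(u) z‖ ≤ 1∕8`, same for `v`). [folklore] -/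
theorem norm_cornerLog_sub_le [Nonempty n] {L : ℕ} (k : ℕ) {u v : Site d → (Matrix n n ℂ)ˣ}
    (hcu : ∀ z, ((u (((L : ℤ) ^ (k + 1)) • z) : (Matrix n n ℂ)ˣ) : Matrix n n ℂ) = exp (cornerLog L k u z)) (hhu : ∀ z, ‖cornerLog L k u z‖ ≤ 1 / 8)
    (hcv : ∀ z, ((v (((L : ℤ) ^ (k + 1)) • z) : (Matrix n n ℂ)ˣ) : Matrix n n ℂ) = exp (cornerLog L k v z)) (hhv : ∀ z, ‖cornerLog L k v z‖ ≤ 1 / 8)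
    (z : Site d) :
    ‖cornerLog L k u z - cornerLog L k v z‖
      ≤ 4 / 3 * ‖((u (((L : ℤ) ^ (k + 1)) • z) : (Matrix n n ℂ)ˣ) : Matrix n n ℂ) - (v (((L : ℤ) ^ (k + 1)) • z) : (Matrix n n ℂ)ˣ)‖ := by
  have hA : ‖((u (((L : ℤ) ^ (k + 1)) • z) : (Matrix n n ℂ)ˣ) : Matrix n n ℂ) - 1‖ ≤ 1 / 4 := by
    rw [hcu z]; exact (norm_exp_sub_one_le_two_mul (hhu z) (by norm_num)).1.trans (by norm_num)
  have hB : ‖((v (((L : ℤ) ^ (k + 1)) • z) : (Matrix n n ℂ)ˣ) : Matrix n n ℂ) - 1‖ ≤ 1 / 4 := by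
    rw [hcv z]; exact (norm_exp_sub_one_le_two_mul (hhv z) (by norm_num)).1.trans (by norm_num)
  unfold cornerLog
  exact norm_mlog_sub_mlog_le_four_thirds (le_refl (1 / 4 : ℝ)) hA hB

/-! ## §2 The sup letters of the state maps' differences in the class -/

section Sup

variable [Nonempty n] {L : ℕ} (hL : 2 ≤ L) (k : ℕ) {W : Site d → Fin d → (Matrix n n ℂ)ˣ} {x : ℝ} (hWu : IsUnitaryCfg W) (hx : 0 ≤ x) (hs : LevelSmall d L k x)
  (hWx : SmallField W x) (N : ℕ) [NeZero N] (hθ : cruxC d L * (((L : ℝ) ^ (k + 1)) ^ 2 * x) < 1) (U' : Site d → Fin d → (Matrix n n ℂ)ˣ)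
  (hWP : IsPeriodicCfg W ((tower L N (k + 1) : ℕ) : ℤ)) (hU'u : IsUnitaryCfg U') (hU'P : IsPeriodicCfg U' ((tower L N (k + 1) : ℕ) : ℤ))
  (hε : ((L : ℝ) ^ (k + 1)) ^ 2 * x ≤ 1) (hA : curvSum d L (k + 1) x ≤ 2 / 3 * L)
  {u v : Site d → (Matrix n n ℂ)ˣ} (hu : IsUnitarySite u) (huP : IsPeriodicSite u ((tower L N (k + 1) : ℕ) : ℤ))
  (hgu : gaugeAct u U' = vary W (repLog W U' u) 1) (hXu : ∀ y κ, ‖repLog W U' u y κ‖ ≤ 1 / 8)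
  (hcu : ∀ z, ((u (((L : ℤ) ^ (k + 1)) • z) : (Matrix n n ℂ)ˣ) : Matrix n n ℂ) = exp (cornerLog L k u z)) (hhu : ∀ z, ‖cornerLog L k u z‖ ≤ 1 / 8)
  (hv : IsUnitarySite v) (hvP : IsPeriodicSite v ((tower L N (k + 1) : ℕ) : ℤ))
  (hgv : gaugeAct v U' = vary W (repLog W U' v) 1) (hXv : ∀ y κ, ‖repLog W U' v y κ‖ ≤ 1 / 8)
  (hcv : ∀ z, ((v (((L : ℤ) ^ (k + 1)) • z) : (Matrix n n ℂ)ˣ) : Matrix n n ℂ) = exp (cornerLog L k v z)) (hhv : ∀ z, ‖cornerLog L k v z‖ ≤ 1 / 8)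
  {ρ : ℝ} (hρ : ∀ y, ‖((u y : (Matrix n n ℂ)ˣ) : Matrix n n ℂ) - (v y : (Matrix n n ℂ)ˣ)‖ ≤ ρ)

include hWu hU'u hu hv hgu hXu hgv hXv hρ in
/-- `sup‖X(u) − X(v)‖ ≤ (8∕3)·sup‖u − v‖`. [folklore] -/
theorem norm_repLog_sub_le_sup (y : Site d) (κ : Fin d) : ‖repLog W U' u y κ - repLog W U' v y κ‖ ≤ 8 / 3 * ρ := by
  have h := norm_repLog_sub_le hWu hU'u hu hv hgu hXu hgv hXv y κ
  have h1 := hρ y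
  have h2 := hρ (y + e κ)
  linarith

include hL hWu hx hs hWx hWP hU'u hU'P hu huP hgu hXu hcu hhu hv hvP hgv hXv hcv hhv hρ hA in
/-- **`sup‖φ(u) − φ(v)‖ ≤ (8∕3)((3+12d)·M + 1)·sup‖u − v‖`** (`φ = dirIter X − gaugeDir_V h`: `dirIter_sub` + `norm_dirIter_le_sup`, `gaugeDir` of the difference + `norm_gaugeDir_le_two_mul`).
[folklore] -/
theorem norm_coarseDatum_sub_le (z : Site d) (κ : Fin d) :
    ‖coarseDatum L k W U' u z κ - coarseDatum L k W U' v z κ‖ ≤ 8 / 3 * ((3 + 12 * (d : ℝ)) * (L : ℝ) ^ (k + 1) + 1) * ρ := by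
  have hL1 : 1 ≤ L := le_trans one_le_two hL
  have hρ0 : 0 ≤ ρ := (norm_nonneg _).trans (hρ 0)
  -- the log difference is skew, periodic and `(8/3)ρ`-small
  have hDs : IsSkewDir (fun y μ => repLog W U' u y μ - repLog W U' v y μ) := fun y μ =>
    (skewAdjoint (Matrix n n ℂ)).sub_mem (repLog_skew hWu U' hU'u hu hgu hXu y μ) (repLog_skew hWu U' hU'u hv hgv hXv y μ)
  have hPu : IsPeriodicDir (repLog W U' u) ((tower L N (k + 1) : ℕ) : ℤ) := repLog_periodic k N U' hWP hU'P huP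
  have hPv : IsPeriodicDir (repLog W U' v) ((tower L N (k + 1) : ℕ) : ℤ) := repLog_periodic k N U' hWP hU'P hvP
  have hDP : IsPeriodicDir (fun y μ => repLog W U' u y μ - repLog W U' v y μ) ((tower L N (k + 1) : ℕ) : ℤ) := fun y i μ => by
    show repLog W U' u (y + ((tower L N (k + 1) : ℕ) : ℤ) • e i) μ - repLog W U' v (y + ((tower L N (k + 1) : ℕ) : ℤ) • e i) μ
      = repLog W U' u y μ - repLog W U' v y μ
    rw [hPu y i μ, hPv y i μ]
  have hDsup : ∀ y μ, ‖(fun y μ => repLog W U' u y μ - repLog W U' v y μ) y μ‖ ≤ 8 / 3 * ρ := fun y μ =>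
    norm_repLog_sub_le_sup hWu U' hU'u hu hgu hXu hv hgv hXv hρ y μ
  have h83 : 0 ≤ 8 / 3 * ρ := mul_nonneg (by norm_num) hρ0
  have hdir := norm_dirIter_le_sup hL k hWu hWP hx hs hWx hDs hDP h83 hDsup hA z κ
  have e1 : dirIter L (k + 1) W (fun y μ => repLog W U' u y μ - repLog W U' v y μ) z κ
      = dirIter L (k + 1) W (repLog W U' u) z κ - dirIter L (k + 1) W (repLog W U' v) z κ := by
    rw [dirIter_sub hL1 k hWu hx hs hWx (repLog W U' u) (repLog W U' v)]
  have h1 : ‖dirIter L (k + 1) W (repLog W U' u) z κ - dirIter L (k + 1) W (repLog W U' v) z κ‖ ≤ (3 + 12 * (d : ℝ)) * (L : ℝ) ^ (k + 1) * (8 / 3 * ρ) := by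
    rw [← e1]; exact hdir
  -- the corner-log difference and its coarse gauge direction
  obtain ⟨hVu, -, -, -⟩ := levelData hL1 hWu hx hs hWx (m := k + 1) le_rfl
  have hh : ∀ w, ‖cornerLog L k u w - cornerLog L k v w‖ ≤ 4 / 3 * ρ := fun w =>
    (norm_cornerLog_sub_le k hcu hhu hcv hhv w).trans (mul_le_mul_of_nonneg_left (hρ _) (by norm_num))
  have h2 : ‖gaugeDir (cavgIter L (k + 1) W) (cornerLog L k u) z κ - gaugeDir (cavgIter L (k + 1) W) (cornerLog L k v) z κ‖ ≤ 2 * (4 / 3 * ρ) := by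
    have e : gaugeDir (cavgIter L (k + 1) W) (cornerLog L k u) z κ - gaugeDir (cavgIter L (k + 1) W) (cornerLog L k v) z κ
        = gaugeDir (cavgIter L (k + 1) W) (fun w => cornerLog L k u w - cornerLog L k v w) z κ := by
      simp only [gaugeDir, T4AveragingDeficitNonAbelian.Ad_sub]
      exact (sub_sub_sub_comm _ _ _ _)
    rw [e]
    exact norm_gaugeDir_le_two_mul hVu _ hh z κ
  have e : coarseDatum L k W U' u z κ - coarseDatum L k W U' v z κ
      = (dirIter L (k + 1) W (repLog W U' u) z κ - dirIter L (k + 1) W (repLog W U' v) z κ)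
        - (gaugeDir (cavgIter L (k + 1) W) (cornerLog L k u) z κ - gaugeDir (cavgIter L (k + 1) W) (cornerLog L k v) z κ) :=
    sub_sub_sub_comm _ _ _ _
  rw [e]
  calc ‖(dirIter L (k + 1) W (repLog W U' u) z κ - dirIter L (k + 1) W (repLog W U' v) z κ)
        - (gaugeDir (cavgIter L (k + 1) W) (cornerLog L k u) z κ - gaugeDir (cavgIter L (k + 1) W) (cornerLog L k v) z κ)‖
      ≤ (3 + 12 * (d : ℝ)) * (L : ℝ) ^ (k + 1) * (8 / 3 * ρ) + 2 * (4 / 3 * ρ) := (norm_sub_le _ _).trans (add_le_add h1 h2)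
    _ = 8 / 3 * ((3 + 12 * (d : ℝ)) * (L : ℝ) ^ (k + 1) + 1) * ρ := by ring

include hL hWu hx hs hWx hWP hU'u hU'P hu huP hgu hXu hcu hhu hv hvP hgv hXv hcv hhv hρ hA hε in
/-- **`sup‖N(u) − N(v)‖ ≤ (supC∕(M(1 − cruxC·M²x)))·(8∕3)((3+12d)M + 1)·sup‖u − v‖`** (`rightInvW_sub` + (R5)). [folklore] -/
theorem norm_normalPart_sub_le (y : Site d) (μ : Fin d) :
    ‖normalPart hL k hWu hx hs hWx N hθ U' u y μ - normalPart hL k hWu hx hs hWx N hθ U' v y μ‖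
      ≤ supC d L / ((L : ℝ) ^ (k + 1) * (1 - cruxC d L * (((L : ℝ) ^ (k + 1)) ^ 2 * x)))
        * (8 / 3 * ((3 + 12 * (d : ℝ)) * (L : ℝ) ^ (k + 1) + 1) * ρ) := by
  have hφu := (coarseDatum_skew_periodic hL k hWu hx hs hWx N U' hWP hU'u hU'P hu huP hgu hXu hcu hhu).1
  have hφv := (coarseDatum_skew_periodic hL k hWu hx hs hWx N U' hWP hU'u hU'P hv hvP hgv hXv hcv hhv).1
  have hφd : IsSkewDir (fun y μ => coarseDatum L k W U' u y μ - coarseDatum L k W U' v y μ) := fun y μ =>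
    (skewAdjoint (Matrix n n ℂ)).sub_mem (hφu y μ) (hφv y μ)
  have hρ0 : 0 ≤ ρ := (norm_nonneg _).trans (hρ 0)
  rw [normalPart_eq hL k hWu hx hs hWx N hθ U' hφu, normalPart_eq hL k hWu hx hs hWx N hθ U' hφv,
    ← rightInvW_sub hL k hWu hx hs hWx hθ hφu hφv hφd y μ]
  have hd0 : (0 : ℝ) ≤ (3 + 12 * (d : ℝ)) * (L : ℝ) ^ (k + 1) + 1 := by positivity
  have hs0 : 0 ≤ 8 / 3 * ((3 + 12 * (d : ℝ)) * (L : ℝ) ^ (k + 1) + 1) * ρ := mul_nonneg (mul_nonneg (by norm_num) hd0) hρ0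
  exact norm_rightInvW_le hL k hWu hx hs hWx N hθ hε hφd hs0
    (fun z κ => norm_coarseDatum_sub_le hL k hWu hx hs hWx N U' hWP hU'u hU'P hA hu huP hgu hXu hcu hhu hv hvP hgv hXv hcv hhv hρ z κ) y μ

include hL hWu hx hs hWx hWP hU'u hU'P hu huP hgu hXu hcu hhu hv hvP hgv hXv hcv hhv hρ hA hε in
/-- **THE TANGENT PART IS SUP-LIPSCHITZ IN THE GAUGE ON THE WORKING REGION**: `‖T(u)(b) − T(v)(b)‖ ≤ lipT·sup‖u − v‖`,
`lipT = (8∕3)(1 + (supC∕(M(1 − cruxC·M²x)))·((3+12d)M + 1))`. [folklore] -/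
theorem norm_tangentPart_sub_le (y : Site d) (μ : Fin d) :
    ‖tangentPart hL k hWu hx hs hWx N hθ U' u y μ - tangentPart hL k hWu hx hs hWx N hθ U' v y μ‖
      ≤ (8 / 3 * (1 + supC d L / ((L : ℝ) ^ (k + 1) * (1 - cruxC d L * (((L : ℝ) ^ (k + 1)) ^ 2 * x))) * ((3 + 12 * (d : ℝ)) * (L : ℝ) ^ (k + 1) + 1))) * ρ := by
  have h1 := norm_repLog_sub_le_sup hWu U' hU'u hu hgu hXu hv hgv hXv hρ y μ
  have h2 := norm_normalPart_sub_le hL k hWu hx hs hWx N hθ U' hWP hU'u hU'P hε hA hu huP hgu hXu hcu hhu hv hvP hgv hXv hcv hhv hρ y μ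
  have e : tangentPart hL k hWu hx hs hWx N hθ U' u y μ - tangentPart hL k hWu hx hs hWx N hθ U' v y μ
      = (repLog W U' u y μ - repLog W U' v y μ) - (normalPart hL k hWu hx hs hWx N hθ U' u y μ - normalPart hL k hWu hx hs hWx N hθ U' v y μ) :=
    sub_sub_sub_comm _ _ _ _
  rw [e]
  calc ‖(repLog W U' u y μ - repLog W U' v y μ) - (normalPart hL k hWu hx hs hWx N hθ U' u y μ - normalPart hL k hWu hx hs hWx N hθ U' v y μ)‖
      ≤ 8 / 3 * ρ + supC d L / ((L : ℝ) ^ (k + 1) * (1 - cruxC d L * (((L : ℝ) ^ (k + 1)) ^ 2 * x)))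
          * (8 / 3 * ((3 + 12 * (d : ℝ)) * (L : ℝ) ^ (k + 1) + 1) * ρ) := (norm_sub_le _ _).trans (add_le_add h1 h2)
    _ = _ := by ring

end Sup

/-! ## §3 The slice part is `Df`-close to the tangent part; the limit lies in the slice -/

section Limit

variable [Nonempty n] {L : ℕ} (hL : 2 ≤ L) (k : ℕ) {W : Site d → Fin d → (Matrix n n ℂ)ˣ} {x : ℝ} (hWu : IsUnitaryCfg W) (hx : 0 ≤ x) (hs : LevelSmall d L k x)
  (hWx : SmallField W x) (N : ℕ) [NeZero N] (hθ : cruxC d L * (((L : ℝ) ^ (k + 1)) ^ 2 * x) < 1) (U' : Site d → Fin d → (Matrix n n ℂ)ˣ)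
  (hWP : IsPeriodicCfg W ((tower L N (k + 1) : ℕ) : ℤ)) (hU'u : IsUnitaryCfg U') (hU'P : IsPeriodicCfg U' ((tower L N (k + 1) : ℕ) : ℤ))
  (hε : ((L : ℝ) ^ (k + 1)) ^ 2 * x ≤ 1) (hA : curvSum d L (k + 1) x ≤ 2 / 3 * L)

include hWP hU'u hU'P in
/-- **`‖Ỹ(u)(b) − T(u)(b)‖ ≤ Df(u)`** on the working region (`Ỹ(u) = T(u) − gaugeDir W ζ(u)`, `‖gaugeDir W ζ(u)‖ ≤ δ(u) ≤ Df(u)`). [folklore] -/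
theorem norm_slicePart_sub_tangentPart_le {u : Site d → (Matrix n n ℂ)ˣ} (hu : IsUnitarySite u) (huP : IsPeriodicSite u ((tower L N (k + 1) : ℕ) : ℤ))
    (hgu : gaugeAct u U' = vary W (repLog W U' u) 1) (hXu : ∀ y κ, ‖repLog W U' u y κ‖ ≤ 1 / 8)
    (hcu : ∀ z, ((u (((L : ℤ) ^ (k + 1)) • z) : (Matrix n n ℂ)ˣ) : Matrix n n ℂ) = exp (cornerLog L k u z)) (hhu : ∀ z, ‖cornerLog L k u z‖ ≤ 1 / 8)
    (y : Site d) (μ : Fin d) :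
    ‖slicePart hL k hWu hx hs hWx N hθ U' u y μ - tangentPart hL k hWu hx hs hWx N hθ U' u y μ‖ ≤ sliceDefect hL k hWu hx hs hWx N hθ U' u := by
  have hsp := split_holds hL k hWu hx hs hWx N hθ U' hWP hU'u hU'P hu huP hgu hXu hcu hhu
  have hT := hsp.2.2.2.1 y μ
  have e : slicePart hL k hWu hx hs hWx N hθ U' u y μ - tangentPart hL k hWu hx hs hWx N hθ U' u y μ
      = -gaugeDir W (gaugeFun hL k hWu hx hs hWx N hθ U' u) y μ := by rw [hT]; exact sub_add_cancel_left _ _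
  rw [e, norm_neg]
  exact (norm_gaugeDir_gaugeFun_le hL k hWu hx hs hWx N hθ U' hWP hU'u hU'P hu huP hgu hXu hcu hhu y μ).trans
    (delta_le_sliceDefect hL k hWu hx hs hWx N hθ U' u)

include hWP hU'u hU'P hε hA in
/-- **F4d-iii `tangentPart_limit_mem` — THE TANGENT PART OF THE ORBIT's LIMIT IS IN THE ENERGY SLICE.**  Multi-level small-field class at `W` (`L ≥ 2`, `M²x ≤ 1`, `curvSum ≤ 2L∕3`,
`cruxC·M²x < 1`), `W`, `U′` unitary `(tower)`-periodic.  Let `u : ℕ → gauges` and `u⋆` all lie in the working region (unitary, `(tower)`-periodic, chart `U′^{u} = W·e^{X(u)}` with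
`‖X(u)‖ ≤ 1∕8`, corners `u(M•z) = e^{h(u) z}` with `‖h(u)‖ ≤ 1∕8`), let `u j → u⋆` at a UNIFORM rate (`‖u j y − u⋆ y‖ ≤ r j` for all `y`, `r j → 0` — the Cauchy engine
`NE7DefectIterationCauchy.exists_orbit_limit` gives `r j = B·δ₀·θ^j∕(1−θ)`), and let the slice defect vanish along the orbit (`Df(u j) → 0`).  THEN `T(u⋆) ∈ 𝒯_E(W) =
energyBlockLandauW L N (k+1) W` — by `NE7EnergySliceClosed.mem_energyBlockLandauW_of_tendsto` applied to `Ỹ(u j) ∈ 𝒯_E(W)`, which converge sitewise to `T(u⋆)`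
(`‖Ỹ(u j) − T(u⋆)‖ ≤ Df(u j) + lipT·r j`). [folklore] -/
theorem tangentPart_limit_mem (u : ℕ → Site d → (Matrix n n ℂ)ˣ) (ulim : Site d → (Matrix n n ℂ)ˣ)
    (hu : ∀ j, IsUnitarySite (u j)) (huP : ∀ j, IsPeriodicSite (u j) ((tower L N (k + 1) : ℕ) : ℤ))
    (hgu : ∀ j, gaugeAct (u j) U' = vary W (repLog W U' (u j)) 1) (hXu : ∀ j y κ, ‖repLog W U' (u j) y κ‖ ≤ 1 / 8)
    (hcu : ∀ j z, (((u j) (((L : ℤ) ^ (k + 1)) • z) : (Matrix n n ℂ)ˣ) : Matrix n n ℂ) = exp (cornerLog L k (u j) z)) (hhu : ∀ j z, ‖cornerLog L k (u j) z‖ ≤ 1 / 8)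
    (hl : IsUnitarySite ulim) (hlP : IsPeriodicSite ulim ((tower L N (k + 1) : ℕ) : ℤ))
    (hgl : gaugeAct ulim U' = vary W (repLog W U' ulim) 1) (hXl : ∀ y κ, ‖repLog W U' ulim y κ‖ ≤ 1 / 8)
    (hcl : ∀ z, ((ulim (((L : ℤ) ^ (k + 1)) • z) : (Matrix n n ℂ)ˣ) : Matrix n n ℂ) = exp (cornerLog L k ulim z)) (hhl : ∀ z, ‖cornerLog L k ulim z‖ ≤ 1 / 8)
    (r : ℕ → ℝ) (hrate : ∀ j y, ‖(((u j) y : (Matrix n n ℂ)ˣ) : Matrix n n ℂ) - (ulim y : (Matrix n n ℂ)ˣ)‖ ≤ r j) (hr : Tendsto r atTop (𝓝 0))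
    (hDf : Tendsto (fun j => sliceDefect hL k hWu hx hs hWx N hθ U' (u j)) atTop (𝓝 0)) :
    tangentPart hL k hWu hx hs hWx N hθ U' ulim ∈ energyBlockLandauW (d := d) (n := n) L N (k + 1) W := by
  set C : ℝ := 8 / 3 * (1 + supC d L / ((L : ℝ) ^ (k + 1) * (1 - cruxC d L * (((L : ℝ) ^ (k + 1)) ^ 2 * x))) * ((3 + 12 * (d : ℝ)) * (L : ℝ) ^ (k + 1) + 1))
    with hC
  refine mem_energyBlockLandauW_of_tendsto hL k hWu hx hs hWx (Y := fun j => slicePart hL k hWu hx hs hWx N hθ U' (u j))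
    (fun j => (split_holds hL k hWu hx hs hWx N hθ U' hWP hU'u hU'P (hu j) (huP j) (hgu j) (hXu j) (hcu j) (hhu j)).2.2.1) fun y μ => ?_
  -- sitewise: ‖Ỹ(u j) − T(u⋆)‖ ≤ Df(u j) + C·r j → 0
  have hbound : ∀ j, ‖slicePart hL k hWu hx hs hWx N hθ U' (u j) y μ - tangentPart hL k hWu hx hs hWx N hθ U' ulim y μ‖
      ≤ sliceDefect hL k hWu hx hs hWx N hθ U' (u j) + C * r j := fun j => by
    have h1 := norm_slicePart_sub_tangentPart_le hL k hWu hx hs hWx N hθ U' hWP hU'u hU'P (hu j) (huP j) (hgu j) (hXu j) (hcu j) (hhu j) y μ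
    have h2 := norm_tangentPart_sub_le hL k hWu hx hs hWx N hθ U' hWP hU'u hU'P hε hA (hu j) (huP j) (hgu j) (hXu j) (hcu j) (hhu j)
      hl hlP hgl hXl hcl hhl (hrate j) y μ
    calc ‖slicePart hL k hWu hx hs hWx N hθ U' (u j) y μ - tangentPart hL k hWu hx hs hWx N hθ U' ulim y μ‖
        ≤ ‖slicePart hL k hWu hx hs hWx N hθ U' (u j) y μ - tangentPart hL k hWu hx hs hWx N hθ U' (u j) y μ‖
          + ‖tangentPart hL k hWu hx hs hWx N hθ U' (u j) y μ - tangentPart hL k hWu hx hs hWx N hθ U' ulim y μ‖ := norm_sub_le_norm_sub_add_norm_sub _ _ _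
      _ ≤ sliceDefect hL k hWu hx hs hWx N hθ U' (u j) + C * r j := add_le_add h1 (by rw [hC]; exact h2)
  have hlim0 : Tendsto (fun j => sliceDefect hL k hWu hx hs hWx N hθ U' (u j) + C * r j) atTop (𝓝 0) := by
    have := hDf.add (hr.const_mul C)
    simpa using this
  rw [tendsto_iff_norm_sub_tendsto_zero]
  exact squeeze_zero (fun j => norm_nonneg _) hbound hlim0

end Limit

end

end Summit.QuantumFields.BalabanUV.T4Continuum.NE7SliceTangentPartLimit
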